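import Literature.NumberTheory.Sieve.GoldstonPintzYildirimLemma3Pieces
import HarnessLib

/-!
# Goldston–Pintz–Yıldırım, Lemma 3 — assembly of the explicit bound

Trunk: NumberTheory / Sieve, continuing `GoldstonPintzYildirimLemma3Pieces` (GPY, *Primes in
tuples I*, §8, Lemma 3, (8.4)–(8.6)). The pieces of the two-stage contour argument proved in
`…Lemma3Setup/Inner/Outer/Diag/Pieces` are put together into ONE explicit inequality

  `‖𝒯*_R(a,b,d,u,v) − G(0,0) · C(u+v,u) (log R)^{u+v+d}/(u+v+d)!‖ ≤ lemma3Err(B, C, R, η, θ, η₀, σ_w, σ₀, ρ, T)`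

(`norm_lemma3T_sub_main_le`), valid for every holomorphic `G` on `{Re sᵢ > −1/4}` bounded by `B`
on the strip `−κ ≤ Re sᵢ ≤ 2`, every `R ≥ 1`, `a + u ≥ 1`, `b + v ≥ 1`, and every admissible
choice of the contour parameters (both lines at `Re sᵢ = θ`, inner residue squares of size `η`
and `3η`, inner left edge `Re w = −σ_w`, outer left edge `Re s₂ = −σ₀`, truncation heights `T`
and `2T`, bump height `η₀`, Cauchy radius `ρ`), the admissibility being a short list of linear
inequalities plus two zero-free-region conditions. The error `lemma3Err` is the sum of the seven
explicit error terms of the pieces (outer truncation, inner error `E_w`, perturbation of the double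
residue, two horizontal connectors and the left edge of the outer rectangle, and the diagonal term
`I₃`); with `θ ≍ η ≍ 1/log R`, `η₀ ≍ ρ ≍ σ ≍ 1/log log R`, `T = (log R)^{O(1)}` every one of them
is `o((log R)^{u+v+d})` when `B = (log log R)^{O(1)}` (the `o(1)`-form is derived in the sequel).
Everything here is PROVED:

* `norm_integral_diagRes_le` — the whole diagonal term on `|t₂| ≤ T`: far parts + bump;
* `lemma3_abstract_bound` — the bookkeeping: the error identity
  `𝒯* − G(0,0)·main = (2π)⁻² (E_t + E_w − i·I₃ − ∮P + ∫_bot − ∫_top − i ∫_left)` and the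
  triangle inequality;
* `lemma3ErrT`, `lemma3ErrW`, `lemma3ErrP`, `lemma3ErrH`, `lemma3ErrL`, `lemma3ErrD`, `lemma3Err` —
  the explicit error terms (real-valued bookkeeping definitions, no new facts);
* `norm_lemma3T_sub_main_le` — the explicit bound.

## References

* D. A. Goldston, J. Pintz, C. Y. Yıldırım, *Primes in tuples. I*, Ann. of Math. (2) 170 (2009),
  819–862 = arXiv:math/0508185, §8, Lemma 3, (8.4)–(8.24). [cite: GoldstonPintzYildirim2009]
-/

noncomputable section

open Complex Filter Topology MeasureTheory Set intervalIntegral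
open scoped Real Interval

namespace Literature.NumberTheory.Sieve.GPY

open Literature.Analysis.Complex (rectBoundaryIntegral)
open Literature.NumberTheory.LFunctions.Nicolas (zetaOne zetaOne_zero differentiable_zetaOne zetaOne_of_ne_zero)

section Assembly

variable {G : ℂ → ℂ → ℂ} {cbar C : ℝ}

/-! ### The whole diagonal term -/

/-- **The diagonal term `I₃` on `|t₂| ≤ T`**: splitting `∫_{−T}^{T} r(θ+it) dt` at `±η₀`, the far
parts are bounded by `norm_integral_diagRes_far_le` and the middle part, after the bump
(`diagRes_bump_identity` with `X = η₀`, `Y = Y′ = 2η₀`), by `norm_diagRes_bump_le`: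
`‖∫_{−T}^{T} r(θ+it) dt‖ ≤ K_r (2(1/((q−1)η₀^{q−1}) + 1/((u+v+1)η₀^{u+v+1})) + 8 η₀/η₀^{q})`,
`q = u+v+a+b+2`. [cite: GoldstonPintzYildirim2009, Section 8 eq. 8.23] -/
theorem norm_integral_diagRes_le
    (hWz : ∀ z : ℂ, z ≠ 0 → -(4 * cbar / Real.log (|z.im| + 3)) ≤ z.re →
      zetaOne z ≠ 0 ∧ ‖(zetaOne z)⁻¹‖ ≤ C * Real.log (|z.im| + 3) / ‖z‖ ∧
        ‖zetaOne z‖ ≤ 1 + C * ‖z‖ * Real.log (|z.im| + 3))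
    (hc : 0 ≤ cbar) (hC : 0 ≤ C) {B κ ρW : ℝ} (hB0 : 0 ≤ B)
    (hG : DifferentiableOn ℂ (fun z : ℂ × ℂ => G z.1 z.2) G₂Region)
    (hGB : ∀ s₁ s₂ : ℂ, -κ ≤ s₁.re → s₁.re ≤ 2 → -κ ≤ s₂.re → s₂.re ≤ 2 → ‖G s₁ s₂‖ ≤ B)
    (hρ : ∀ s : ℂ, ‖s‖ ≤ ρW → 1 / 2 ≤ ‖zetaOne s‖ ∧ ‖zetaOne s‖ ≤ 3 / 2)
    {R : ℝ} (hR : 1 ≤ R) (a b d u v : ℕ) {η θ η₀ T : ℝ} (hη : 0 < η) (hη1 : η ≤ 1)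
    (hηρ : 2 * η ≤ ρW) (hθ : 4 * η ≤ θ) (hθη₀ : θ ≤ η₀) (hη₀1 : η₀ ≤ 1) (hη₀T : η₀ ≤ T)
    (hκ : η + η₀ ≤ κ) (hq1 : η + 2 * η₀ < 1 / 4) (hq2 : η + 2 * θ < 1 / 4)
    (hz1 : η + 2 * η₀ ≤ 4 * cbar / Real.log (η + 2 * η₀ + 3))
    (hz2 : η + θ ≤ 4 * cbar / Real.log (T + η + 3))
    (hz3 : η + 2 * θ ≤ 4 * cbar / Real.log (η + (T + 1) + 3)) :
    ‖∫ t : ℝ in (-T)..T, diagRes G R a b d u v η ((θ : ℂ) + t * I)‖ ≤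
      diagConst B C R η a b d u *
        (2 * (1 / ((u + v + a + b + 1 : ℕ) * η₀ ^ (u + v + a + b + 1)) +
            1 / ((u + v + 1 : ℕ) * η₀ ^ (u + v + 1))) +
          8 * (η₀ * (η₀ ^ ((u + 1 + a) + (v + 1 + b)))⁻¹)) := by
  have hR0 : 0 < R := by linarith
  have hη₀ : 0 < η₀ := by linarith
  have hWz' : ∀ z : ℂ, z ≠ 0 → -(4 * cbar / Real.log (|z.im| + 3)) ≤ z.re → zetaOne z ≠ 0 :=
    fun z hz h => (hWz z hz h).1
  -- interval integrability on `[-T, T]`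
  have hcont := continuousOn_diagRes_line hWz' hc hG hR0 a b d u v hη hθ hq2 hz3 (T := T)
  have hii : ∀ x y : ℝ, x ∈ Icc (-T) T → y ∈ Icc (-T) T →
      IntervalIntegrable (fun t : ℝ => diagRes G R a b d u v η ((θ : ℂ) + t * I)) volume x y := by
    intro x y hx hy
    exact (hcont.mono (Set.uIcc_subset_Icc hx hy)).intervalIntegrable
  have hTm : -T ∈ Icc (-T) T := ⟨le_rfl, by linarith⟩
  have hTp : T ∈ Icc (-T) T := ⟨by linarith, le_rfl⟩
  have hηm : -η₀ ∈ Icc (-T) T := ⟨by linarith, by linarith⟩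
  have hηp : η₀ ∈ Icc (-T) T := ⟨by linarith, by linarith⟩
  have hsplit : (∫ t in (-T)..T, diagRes G R a b d u v η ((θ : ℂ) + t * I)) =
      (∫ t in (-T)..(-η₀), diagRes G R a b d u v η ((θ : ℂ) + t * I)) +
        (∫ t in (-η₀)..η₀, diagRes G R a b d u v η ((θ : ℂ) + t * I)) +
        ∫ t in η₀..T, diagRes G R a b d u v η ((θ : ℂ) + t * I) := by
    rw [integral_add_adjacent_intervals (hii _ _ hTm hηm) (hii _ _ hηm hηp),
      integral_add_adjacent_intervals (hii _ _ hTm hηp) (hii _ _ hηp hTp)]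
  -- the far parts
  obtain ⟨hfar1, hfar2⟩ := norm_integral_diagRes_far_le hWz hc hC hB0 hGB hρ hR a b d u v hη hη1 hηρ
    hθ (by linarith) (by linarith) hη₀ hη₀T hz2 (κ := κ)
  -- the bump
  have hbumpid := diagRes_bump_identity hWz' hc hG hR0 a b d u v (η := η) (θ := θ) (X := η₀)
    (Y := 2 * η₀) (Y' := 2 * η₀) (η₀ := η₀) hη hθ hθη₀ (by linarith) hη₀ (by linarith) hq1 hz1
  have hz1' : η + η₀ ≤ 4 * cbar / Real.log (η₀ + η + 3) := by
    refine le_trans (by linarith) (hz1.trans ?_)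
    exact div_le_div_of_nonneg_left (by linarith) (Real.log_pos (by linarith))
      (Real.log_le_log (by linarith) (by linarith))
  have hbump := norm_diagRes_bump_le hWz hc hC hB0 hGB hρ hR a b d u v hη hη1 hηρ hθ hθη₀ hη₀1 hκ
    (by linarith) hz1'
  have hmid : ‖∫ t in (-η₀)..η₀, diagRes G R a b d u v η ((θ : ℂ) + t * I)‖ ≤
      8 * diagConst B C R η a b d u * (η₀ * (η₀ ^ ((u + 1 + a) + (v + 1 + b)))⁻¹) := by
    have hn : ‖∫ t in (-η₀)..η₀, diagRes G R a b d u v η ((θ : ℂ) + t * I)‖ =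
        ‖I * ∫ t in (-η₀)..η₀, diagRes G R a b d u v η ((θ : ℂ) + t * I)‖ := by
      rw [norm_mul, Complex.norm_I, one_mul]
    rw [hn, hbumpid]
    refine le_trans ?_ hbump
    refine (norm_add_le _ _).trans (add_le_add ((norm_sub_le _ _).trans le_rfl) ?_)
    rw [norm_mul, Complex.norm_I, one_mul]
  have hK := diagConst_nonneg hB0 hR0.le hη.le a b d u (C := C)
  rw [hsplit]
  calc _ ≤ ‖(∫ t in (-T)..(-η₀), diagRes G R a b d u v η ((θ : ℂ) + t * I)) +
          (∫ t in (-η₀)..η₀, diagRes G R a b d u v η ((θ : ℂ) + t * I))‖ +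
        ‖∫ t in η₀..T, diagRes G R a b d u v η ((θ : ℂ) + t * I)‖ := norm_add_le _ _
    _ ≤ ‖∫ t in (-T)..(-η₀), diagRes G R a b d u v η ((θ : ℂ) + t * I)‖ +
          ‖∫ t in (-η₀)..η₀, diagRes G R a b d u v η ((θ : ℂ) + t * I)‖ +
        ‖∫ t in η₀..T, diagRes G R a b d u v η ((θ : ℂ) + t * I)‖ :=
        add_le_add (norm_add_le _ _) le_rfl
    _ ≤ _ := by
        refine (add_le_add (add_le_add hfar2 hmid) hfar1).trans (le_of_eq ?_)
        ring

/-! ### The explicit error terms -/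

/-- Outer truncation error `E_t = 2 M_Φ/T`, `M_Φ = B K(θ,θ) R^{2θ} π/θ^{u+a}` (`norm_Et_le`).
[cite: GoldstonPintzYildirim2009, Section 8 eq. 8.6] -/
def lemma3ErrT (B R θ T : ℝ) (a b d u : ℕ) : ℝ :=
  2 * (B * lineConst θ θ a b d * R ^ (θ + θ) * (Real.pi / θ ^ (u + a)) / T)

/-- Inner error `E_w = EwCoef · π/θ^{v+b}` (`norm_integral_Ew_le`).
[cite: GoldstonPintzYildirim2009, Section 8 eq. 8.19] -/
def lemma3ErrW (B C R θ σw T : ℝ) (a b d u v : ℕ) : ℝ :=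
  EwCoef B C R θ σw T a b d u * (Real.pi / θ ^ (v + b))

/-- Perturbation of the double residue, `η′ = 3η` (`norm_rectBoundaryIntegral_pertInner_le`).
[cite: GoldstonPintzYildirim2009, Section 8 eq. 8.13] -/
def lemma3ErrP (B R η ρ : ℝ) (a b d u v : ℕ) : ℝ :=
  8 * (3 * η) * (8 * η * (B * (3 / 2) ^ d * 2 ^ a * 2 ^ b / ρ * (2 * η + 2 * (3 * η)) *
    Real.exp (Real.log R * (η + 3 * η)) / (η ^ (u + 1) * (3 * η) ^ (v + 1) * (3 * η - 2 * η) ^ d)))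

/-- One horizontal connector of the outer rectangle (`norm_integral_zeroRes_horizontal_le`).
[cite: GoldstonPintzYildirim2009, Section 8 eq. 8.17] -/
def lemma3ErrH (B C R η θ σ₀ T : ℝ) (a b d u v : ℕ) : ℝ :=
  (θ + σ₀) * (8 * η * (B * (1 / (2 * η) + C * Real.log (T + η + 3)) ^ d * (4 * η) ^ a *
    (C * Real.log (T + η + 3)) ^ b * R ^ (η + θ) * ((η ^ (u + 1 + a))⁻¹ * (T ^ (v + 1 + b))⁻¹)))

/-- The left edge of the outer rectangle (`norm_integral_zeroRes_left_le`).
[cite: GoldstonPintzYildirim2009, Section 8 eq. 8.19] -/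
def lemma3ErrL (B C R η σ₀ T : ℝ) (a b d u v : ℕ) : ℝ :=
  8 * η * (B * (1 / (2 * η) + C * Real.log (T + η + 3)) ^ d * (4 * η) ^ a *
    (C * Real.log (T + η + 3)) ^ b * R ^ (η + -σ₀) * (η ^ (u + 1 + a))⁻¹) * (Real.pi / σ₀ ^ (v + b))

/-- The diagonal term `I₃` (`norm_integral_diagRes_le`).
[cite: GoldstonPintzYildirim2009, Section 8 eq. 8.23] -/
def lemma3ErrD (B C R η η₀ : ℝ) (a b d u v : ℕ) : ℝ :=
  diagConst B C R η a b d u *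
    (2 * (1 / ((u + v + a + b + 1 : ℕ) * η₀ ^ (u + v + a + b + 1)) +
        1 / ((u + v + 1 : ℕ) * η₀ ^ (u + v + 1))) +
      8 * (η₀ * (η₀ ^ ((u + 1 + a) + (v + 1 + b)))⁻¹))

/-- **The total error of Lemma 3** in explicit form:
`(2π)⁻² (E_t + E_w + E_P + 2 E_H + E_L + E_D)`. [cite: GoldstonPintzYildirim2009, Section 8 eq. 8.6] -/
def lemma3Err (B C R η θ η₀ σw σ₀ ρ T : ℝ) (a b d u v : ℕ) : ℝ :=
  1 / (2 * Real.pi) ^ 2 *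
    (lemma3ErrT B R θ T a b d u + lemma3ErrW B C R θ σw T a b d u v + lemma3ErrP B R η ρ a b d u v +
      2 * lemma3ErrH B C R η θ σ₀ T a b d u v + lemma3ErrL B C R η σ₀ T a b d u v +
      lemma3ErrD B C R η η₀ a b d u v)

/-- `EwCoef ≥ 0` (`B, C ≥ 0`, `θ, σ_w, T > 0`, `R ≥ 0`). [folklore] -/
theorem EwCoef_nonneg {B C R θ σw T : ℝ} (hB : 0 ≤ B) (hC : 0 ≤ C) (hR : 0 ≤ R) (hθ : 0 < θ)
    (hσw : 0 < σw) (hT : 0 < T) (a b d u : ℕ) : 0 ≤ EwCoef B C R θ σw T a b d u := by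
  unfold EwCoef
  have h1 : 0 < Real.log (2 * T + T + 3) := Real.log_pos (by linarith)
  have h2 : 0 < 2 * T - T := by linarith
  positivity

/-! ### The error identity -/

/-- `(2π)⁻² · (2πi)² = −1`. [folklore] -/
theorem inv_two_pi_sq_mul : (1 / (2 * Real.pi) ^ 2 : ℂ) * (2 * Real.pi * I) ^ 2 = -1 := by
  have hπ : (Real.pi : ℂ) ≠ 0 := by exact_mod_cast Real.pi_ne_zero
  have h : (2 * (Real.pi : ℂ) * I) ^ 2 = -((2 * Real.pi) ^ 2) := by
    rw [mul_pow, Complex.I_sq]; ring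
  rw [h, mul_neg, one_div_mul_cancel (pow_ne_zero 2 (mul_ne_zero two_ne_zero hπ))]

/-- `‖(2π)⁻²‖ = (2π)⁻²`. [folklore] -/
theorem norm_inv_two_pi_sq : ‖(1 / (2 * Real.pi) ^ 2 : ℂ)‖ = 1 / (2 * Real.pi) ^ 2 := by
  rw [norm_div, norm_one, norm_pow, norm_mul, Complex.norm_real, Real.norm_eq_abs,
    abs_of_pos Real.pi_pos]
  norm_num

/-- **The algebra of the assembly** (pure bookkeeping): from the three identities (inner
decomposition integrated, outer decomposition, double residue = main + perturbation), the value
`(2π)⁻²(2πi)² = −1`, `D(0,0) = G(0,0)` and bounds for the seven pieces, the bound for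
`(2π)⁻² ∫Φ − G(0,0)·main`. [folklore] -/
theorem lemma3_abstract_bound {c k G00 D00 m Φfull Φseg Ew Dg Z Sq Bot Top Lft Pt : ℂ}
    {eT eW eD eP eH eH' eL : ℝ} (hD00 : D00 = G00) (hcI : c * k = -1)
    (hPhi : Φseg = Ew - I * Dg - I * Z) (hZ : I * Z = Sq - Bot + Top + I * Lft)
    (hM : Sq = D00 * (k * m) + Pt)
    (hEt : ‖Φfull - Φseg‖ ≤ eT) (hEw : ‖Ew‖ ≤ eW) (hDg : ‖Dg‖ ≤ eD) (hPt : ‖Pt‖ ≤ eP)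
    (hBot : ‖Bot‖ ≤ eH) (hTop : ‖Top‖ ≤ eH') (hLft : ‖Lft‖ ≤ eL) :
    ‖c * Φfull - G00 * m‖ ≤ ‖c‖ * (eT + eW + eD + eP + eH + eH' + eL) := by
  have hid : c * Φfull - G00 * m = c * ((Φfull - Φseg) + Ew - I * Dg - Pt + Bot - Top - I * Lft) := by
    rw [hD00] at hM
    linear_combination c * hPhi - c * hZ - c * hM - (G00 * m) * hcI
  rw [hid, norm_mul]
  refine mul_le_mul_of_nonneg_left ?_ (norm_nonneg _)
  have hI : ‖I‖ = 1 := Complex.norm_I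
  calc ‖(Φfull - Φseg) + Ew - I * Dg - Pt + Bot - Top - I * Lft‖
      ≤ ‖(Φfull - Φseg) + Ew - I * Dg - Pt + Bot - Top‖ + ‖I * Lft‖ := norm_sub_le _ _
    _ ≤ ‖(Φfull - Φseg) + Ew - I * Dg - Pt + Bot‖ + ‖Top‖ + ‖I * Lft‖ :=
        add_le_add (norm_sub_le _ _) le_rfl
    _ ≤ ‖(Φfull - Φseg) + Ew - I * Dg - Pt‖ + ‖Bot‖ + ‖Top‖ + ‖I * Lft‖ :=
        add_le_add (add_le_add (norm_add_le _ _) le_rfl) le_rfl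
    _ ≤ ‖(Φfull - Φseg) + Ew - I * Dg‖ + ‖Pt‖ + ‖Bot‖ + ‖Top‖ + ‖I * Lft‖ :=
        add_le_add (add_le_add (add_le_add (norm_sub_le _ _) le_rfl) le_rfl) le_rfl
    _ ≤ ‖(Φfull - Φseg) + Ew‖ + ‖I * Dg‖ + ‖Pt‖ + ‖Bot‖ + ‖Top‖ + ‖I * Lft‖ :=
        add_le_add (add_le_add (add_le_add (add_le_add (norm_sub_le _ _) le_rfl) le_rfl) le_rfl)
          le_rfl
    _ ≤ ‖Φfull - Φseg‖ + ‖Ew‖ + ‖I * Dg‖ + ‖Pt‖ + ‖Bot‖ + ‖Top‖ + ‖I * Lft‖ :=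
        add_le_add (add_le_add (add_le_add (add_le_add (add_le_add (norm_add_le _ _) le_rfl)
          le_rfl) le_rfl) le_rfl) le_rfl
    _ = ‖Φfull - Φseg‖ + ‖Ew‖ + ‖Dg‖ + ‖Pt‖ + ‖Bot‖ + ‖Top‖ + ‖Lft‖ := by
        rw [norm_mul, norm_mul, hI, one_mul, one_mul]
    _ ≤ eT + eW + eD + eP + eH + eH' + eL :=
        add_le_add (add_le_add (add_le_add (add_le_add (add_le_add (add_le_add hEt hEw) hDg) hPt)
          hBot) hTop) hLft

/-- **The explicit bound of Lemma 3.** For `G` holomorphic on `{Re sᵢ > −1/4}` with `|G| ≤ B` on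
`−κ ≤ Re sᵢ ≤ 2`, `R ≥ 1`, `a + u ≥ 1`, `b + v ≥ 1`, and admissible contour parameters
(`0 < η`, `4η ≤ θ ≤ η₀ ≤ 1/20`, `6η < ρ`, `6ρ ≤ ρ_W`, `ρ < 1/12`, `max(θ, 4η) ≤ σ₀ ≤ 1/5`,
`η < σ_w`, `σ_w + θ < 1/4`, `T ≥ 1`, the zero-free conditions
`σ₀ + σ_w + θ + η ≤ 4c̄/log(3T+5)` and `η + 2η₀ ≤ 4c̄/log 4`, and
`κ ≥ σ_w + θ, η + η₀, σ₀, 2ρ`):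
`‖𝒯*_R(a,b,d,u,v) − G(0,0) C(u+v,u)(log R)^{u+v+d}/(u+v+d)!‖ ≤ lemma3Err B C R η θ η₀ σ_w σ₀ ρ T a b d u v`.
[cite: GoldstonPintzYildirim2009, Lemma 3] -/
theorem norm_lemma3T_sub_main_le
    (hWz : ∀ z : ℂ, z ≠ 0 → -(4 * cbar / Real.log (|z.im| + 3)) ≤ z.re →
      zetaOne z ≠ 0 ∧ ‖(zetaOne z)⁻¹‖ ≤ C * Real.log (|z.im| + 3) / ‖z‖ ∧
        ‖zetaOne z‖ ≤ 1 + C * ‖z‖ * Real.log (|z.im| + 3))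
    (hc : 0 ≤ cbar) (hC : 0 ≤ C) {ρW : ℝ}
    (hρ : ∀ s : ℂ, ‖s‖ ≤ ρW → 1 / 2 ≤ ‖zetaOne s‖ ∧ ‖zetaOne s‖ ≤ 3 / 2)
    (hG : DifferentiableOn ℂ (fun z : ℂ × ℂ => G z.1 z.2) G₂Region) {B κ : ℝ} (hB0 : 0 ≤ B)
    (hGB : ∀ s₁ s₂ : ℂ, -κ ≤ s₁.re → s₁.re ≤ 2 → -κ ≤ s₂.re → s₂.re ≤ 2 → ‖G s₁ s₂‖ ≤ B)
    {R : ℝ} (hR : 1 ≤ R) {a b d u v : ℕ} (hau : 1 ≤ a + u) (hbv : 1 ≤ b + v)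
    {η θ η₀ σw σ₀ ρ T : ℝ} (hη : 0 < η) (hθ : 4 * η ≤ θ) (hθη₀ : θ ≤ η₀) (hη₀ : η₀ ≤ 1 / 20)
    (hηρ6 : 6 * η < ρ) (hρW : 6 * ρ ≤ ρW) (hρ12 : ρ < 1 / 12) (hθσ₀ : θ ≤ σ₀) (hησ₀ : 4 * η ≤ σ₀)
    (hσ₀5 : σ₀ ≤ 1 / 5) (hσw : η < σw) (hσwq : σw + θ < 1 / 4) (hT : 1 ≤ T)
    (hZ1 : σ₀ + σw + θ + η ≤ 4 * cbar / Real.log (3 * T + 5))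
    (hZ2 : η + 2 * η₀ ≤ 4 * cbar / Real.log 4)
    (hκ1 : σw + θ ≤ κ) (hκ2 : η + η₀ ≤ κ) (hκ3 : σ₀ ≤ κ) (hκ4 : 2 * ρ ≤ κ) :
    ‖lemma3T G R a b d u v -
        G 0 0 * ((((u + v).choose u : ℕ) : ℂ) * (Real.log R : ℂ) ^ (u + v + d) /
          ((u + v + d).factorial : ℂ))‖ ≤
      lemma3Err B C R η θ η₀ σw σ₀ ρ T a b d u v := by
  -- elementary consequences of the admissibility conditions
  have hR0 : 0 < R := by linarith
  have hθ0 : 0 < θ := by linarith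
  have hθ1 : θ ≤ 1 := by linarith
  have hη8 : η < 1 / 8 := by linarith
  have hη1 : η ≤ 1 := by linarith
  have hρ0 : 0 < ρ := by linarith
  have hηρW : 2 * η ≤ ρW := by linarith
  have hκ0 : 0 ≤ κ := by linarith
  have hσw0 : 0 < σw := by linarith
  have hη₀0 : 0 < η₀ := by linarith
  have hWz' : ∀ z : ℂ, z ≠ 0 → -(4 * cbar / Real.log (|z.im| + 3)) ≤ z.re → zetaOne z ≠ 0 :=
    fun z hz h => (hWz z hz h).1
  -- derived `G`-bounds
  have hGBlines : ∀ t₁ t₂ : ℝ, ‖G ((θ : ℂ) + t₁ * I) ((θ : ℂ) + t₂ * I)‖ ≤ B := fun t₁ t₂ =>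
    hGB _ _ (by simp; linarith) (by simp; linarith) (by simp; linarith) (by simp; linarith)
  have hGB01 : ∀ s₁ s₂ : ℂ, 0 < s₁.re → s₁.re ≤ 1 → 0 < s₂.re → s₂.re ≤ 1 → ‖G s₁ s₂‖ ≤ B :=
    fun s₁ s₂ h1 h1' h2 h2' => hGB _ _ (by linarith) (by linarith) (by linarith) (by linarith)
  have hGBball : ∀ s₁ s₂ : ℂ, ‖s₁‖ ≤ 2 * ρ → ‖s₂‖ ≤ 2 * ρ → ‖G s₁ s₂‖ ≤ B := by
    intro s₁ s₂ h1 h2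
    have b1 := abs_le.1 ((Complex.abs_re_le_norm s₁).trans h1)
    have b2 := abs_le.1 ((Complex.abs_re_le_norm s₂).trans h2)
    exact hGB _ _ (by linarith) (by linarith) (by linarith) (by linarith)
  -- zero-free-region comparisons: all heights are `≤ 3T + 5`
  have zf : ∀ x : ℝ, 1 < x → x ≤ 3 * T + 5 →
      4 * cbar / Real.log (3 * T + 5) ≤ 4 * cbar / Real.log x := fun x hx hx' =>
    div_le_div_of_nonneg_left (by linarith) (Real.log_pos hx) (Real.log_le_log (by linarith) hx')
  have zf4 : ∀ x : ℝ, 1 < x → x ≤ 4 → 4 * cbar / Real.log 4 ≤ 4 * cbar / Real.log x := fun x hx hx' =>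
    div_le_div_of_nonneg_left (by linarith) (Real.log_pos hx) (Real.log_le_log (by linarith) hx')
  have hz_phi : η + 2 * θ ≤ 4 * cbar / Real.log (η + (T + 1) + 3) :=
    le_trans (by linarith) (hZ1.trans (zf _ (by linarith) (by linarith)))
  have hz_w : σw + θ ≤ 4 * cbar / Real.log (2 * T + T + 3) :=
    le_trans (by linarith) (hZ1.trans (zf _ (by linarith) (by linarith)))
  have hz_seg : σ₀ ≤ 4 * cbar / Real.log (T + 3) :=
    le_trans (by linarith) (hZ1.trans (zf _ (by linarith) (by linarith)))
  have hz_out : σ₀ + η ≤ 4 * cbar / Real.log (T + η + 3) :=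
    le_trans (by linarith) (hZ1.trans (zf _ (by linarith) (by linarith)))
  have hz_d1 : η + 2 * η₀ ≤ 4 * cbar / Real.log (η + 2 * η₀ + 3) :=
    hZ2.trans (zf4 _ (by linarith) (by linarith))
  have hz_d2 : η + θ ≤ 4 * cbar / Real.log (T + η + 3) := le_trans (by linarith) hz_out
  -- Step 1: both lines moved to `Re sᵢ = θ`
  have h1 : lemma3T G R a b d u v =
      (1 / (2 * Real.pi) ^ 2 : ℂ) * ∫ t₂ : ℝ, lemma3Phi G R a b d u v θ ((θ : ℂ) + t₂ * I) := by
    unfold lemma3T lemma3Phi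
    rw [integral_integral_lemma3F_lines_eq hG hR hau hbv hθ0 hθ1 hθ0 hθ1 hB0 hGB01]
  -- Step 2: truncation of the outer integral
  have hEt := norm_Et_le hG hR0 hau hbv hθ0 hθ1 hB0 hT hGBlines (d := d)
  -- Step 3: the inner decomposition, integrated
  have hPhi := integral_lemma3Phi_eq hWz' hc hG hρ hR0 hau hbv hη hη8 hηρW hθ hθ1 (by linarith)
    hz_phi (by linarith : (0 : ℝ) ≤ T) hB0 hGBlines (d := d)
  have hEw := norm_integral_Ew_le hWz hc hC hB0 hκ0 hG hGB hR hau hbv hη hθ hθ1 hσw hT hz_w hκ1 hσwq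
    (EwCoef_nonneg hB0 hC hR0.le hθ0 hσw0 (by linarith) a b d u) (d := d)
  -- Step 4: the outer decomposition for `ρ₀`
  have hZ := integral_zeroRes_segment_eq hWz' hc hG hρ hR0 a b d u v (η := η) (η' := 3 * η)
    (θ₂ := θ) (σ₀ := σ₀) (T := T) hη hη8 hηρW (by linarith) (by linarith) (by linarith)
    (by linarith) (by linarith) hz_seg
  have hbot := norm_integral_zeroRes_horizontal_le hWz hc hC hB0 hGB hρ hR a b d u v hη hη1 hηρW
    (by linarith : η ≤ κ) hκ3 hθ1 (by linarith : -σ₀ ≤ θ) (by linarith : 4 * η ≤ T) hz_out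
    (Y := -T) (by rw [abs_neg, abs_of_pos (by linarith)])
  have htop := norm_integral_zeroRes_horizontal_le hWz hc hC hB0 hGB hρ hR a b d u v hη hη1 hηρW
    (by linarith : η ≤ κ) hκ3 hθ1 (by linarith : -σ₀ ≤ θ) (by linarith : 4 * η ≤ T) hz_out
    (Y := T) (abs_of_pos (by linarith))
  have hleft := norm_integral_zeroRes_left_le hWz hc hC hB0 hGB hρ hR hbv hη hη1 hηρW
    (by linarith : η ≤ κ) hκ3 hησ₀ (by linarith) (by linarith : (0 : ℝ) ≤ T) hz_out (a := a) (d := d)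
    (u := u)
  -- Step 5: the double residue = main term + perturbation
  have hM := rectBoundaryIntegral_zeroRes_eq hG hρ hR0 a b d u v hη hη8 (by linarith : η < 3 * η)
    (by linarith : 4 * (3 * η) ≤ ρW) (by linarith)
  have hP := norm_rectBoundaryIntegral_pertInner_le hG hρ hρ0 hρW (by linarith) hB0 hGBball hR
    a b d u v hη (by linarith : 2 * η < 3 * η) (by linarith : 2 * (3 * η) < ρ)
  -- Step 6: the diagonal term
  have hD := norm_integral_diagRes_le hWz hc hC hB0 hG hGB hρ hR a b d u v hη hη1 hηρW hθ hθη₀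
    (by linarith) (by linarith) hκ2 (by linarith) (by linarith) hz_d1 hz_d2 hz_phi
  -- the assembly
  rw [h1]
  refine (lemma3_abstract_bound (lemma3D_zero_zero G a b d) inv_two_pi_sq_mul hPhi hZ hM hEt hEw hD hP
    hbot htop hleft).trans (le_of_eq ?_)
  rw [norm_inv_two_pi_sq]
  unfold lemma3Err lemma3ErrT lemma3ErrW lemma3ErrP lemma3ErrH lemma3ErrL lemma3ErrD
  ring

end Assembly

end Literature.NumberTheory.Sieve.GPY
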